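import Summits.ABC.IUTFork.Joshi.ThetaLociSizesReadings
import Mathlib.NumberTheory.Padics.ProperSpace
import HarnessLib

/-!
# Joshi, *Arithmetic Teichmüller Spaces III* (arXiv:2401.13508v4) §9.8: a `p`-ADIC MODEL of the collation signature
# `ATS3.TensorPacketLociDatum` at which EVERY reading predicate of `ThetaLociTensorPackets` / `ThetaLociSizes` HOLDS

Non-vacuity companion (abc-iut cell, branch E, rung LADDER-ABC:A2.E; seat abc-iut-E-t22, slot T-22, generation 2; E-plan-2
policy «AUTHORS FIRST for NV witnesses of their own interface structures», RULINGS 08:35Z / 09:15Z) of the T-22 files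
`ThetaLociTensorPackets` (p428903), `ThetaLociSizes` (p429205) and of the reading hypotheses of `ThetaLociSizesReadings`
(p435679). The only previous inhabitant of the signature in the tree is the DEGENERATE floor `TestThetaLoci.regionLoci`
(p431723: indiscrete topologies, constant collation maps). HERE: a model at a GENUINE `p`-adic field, for every prime `p`
and every `ℓ* ≥ 1` — one place `w` (so `𝕍 = 𝕍^{odd,ss} = {w}`), standard coordinate space `V_w = ℚ_p` with its `p`-adic
topology, log-shell `I(L′_w) = ℤ_p` (compact: `ℚ_p` is proper), the cohomology carriers `H¹_e(arith(L′)_y, ℤ(1))_w := ℤ_p`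
collated by the INCLUSION `ℤ_p ⊂ ℚ_p` (one collation map per `(y, w)`; injective, onto the shell), intrinsic absolute value
`|−|_{K_{y_w}} := ‖−‖_p`, arithmeticoids `y ∈ 𝒴′ := Fin (ℓ*+1)` (labels), ONE Ansatz point (the standard one, extended
tuple `j ↦ y_j := j`), classes READ as (9.7.2.2)/(9.9.2) prescribe: `ξ_{y_j,w} := p*⁻¹·log_p(1 + p*·q_j)` with the
Tate-root stand-ins `q_j := p^{j²} ∈ ℤ_p` (so `|q_j| = p^{−j²} = |q_w^{1/2ℓ}|^{j²/ℓ*²}` with `|q_w^{1/2ℓ}| := p^{−ℓ*²}`,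
print's (9.9.4) root law), unit class `(1+p*)^{1/p^n} ↦ p*⁻¹·log_p(1 + p*) = ξ_{y_0,w}` (`q_0 = 1`), identity convex
closures, tensor codomains = the product spaces themselves with their sup norms (continuous), `𝓘_M → 𝓘_J` = the printed
projection onto the last factor.

PROVED at the model (all non-vacuously: `Σ̃ ∋ z_Θ`, `ℓ* ≥ 1` labels, a genuine compact shell):
* the readings of p435679 hold — isometric collation with the continuous gauge `‖−‖_p` (`padicLociModel_collationReading`),
  the `p`-adic reading of the unit class (`padicLociModel_nrm_one`), the log-reading of the standard norms with the root
  law `j²/ℓ*²` (`padicLociModel_standardNorm`, `norm_padicModelQ_succ_eq_rpow`);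
* hence EVERY reading predicate of the two T-22 files holds there BY THEOREM: `ShellsConvexStableJ/M`, `LocusInShellsJ/M`,
  `CollInjective`, `CollOntoShell` (p428903/p430064); `UnitNormOffSS`, `OneUnitNorm`, `ProdSizeBounded`,
  `PlaceSizeBounded` (p429205) — `padicLociModel_allReadings`; and E-t4's `ValuationScaling` + Thm. 9.9.1's `w`-component
  `FundamentalEstimateSup` for the projection `toLocusDatum` (`padicLociModel_fundamentalEstimateSup`).
So the T-22 signature with all its printed assertions is JOINTLY SATISFIABLE at a `p`-adic field (a model exhibits
satisfiability, nothing more); in particular the hypotheses of every `_of_…Reading` theorem of p435679 are jointly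
satisfiable (R-rules: an implication with unsatisfiable hypotheses is not evidence). What the model does NOT carry: several
places, the Galois/Frobenius symmetries of `Σ̃_{L′}` beyond the identity, genuine tensor products (the codomain maps are
the identity on the product spaces) — labelled, not hidden. Classical; nothing of [IUTchIII] Cor. 3.12 is asserted; no side
taken on any author; typed ≠ proved ≠ endorsed. [claim: Joshi2024ATS3, status: disputed] marks docstrings whose DISPLAY is
Joshi's.
-/

noncomputable section

open Set Metric

namespace Summit.ABC.IUTFork.Joshi.ATS3

open Literature.IUT.LogVolume

variable (p : ℕ) [hp : Fact p.Prime]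

/-! ## 1. The stand-ins `q_j = p^{j²}` and the classes `ξ_j = p*⁻¹·log_p(1 + p*·q_j)` in `ℚ_p` -/

/-- The Tate-root stand-in at label `j`: `q_j := p^{j²} ∈ ℤ_p` (norm `p^{−j²}`; `q_0 = 1`). [folklore] -/
def padicModelQ (j : ℕ) : ℚ_[p] := (p : ℚ_[p]) ^ (j ^ 2)

/-- The class stand-in at label `j`, READ as (9.7.2.2)/(9.9.2) prescribe: `ξ_j := p*⁻¹·log_p(1 + p*·q_j)` (`log_p` = the
tree's `unitLog` on `ℤ_p^×`). [claim: Joshi2024ATS3, status: disputed] -/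
def padicModelXi (j : ℕ) : ℚ_[p] :=
  (((pStar p : ℕ) : ℚ_[p]))⁻¹ * unitLog (1 + ((pStar p : ℕ) : ℚ_[p]) * padicModelQ p j)

/-- `‖q_j‖ = p^{−j²} ≤ 1`. [folklore] -/
theorem norm_padicModelQ (j : ℕ) : ‖padicModelQ p j‖ = ((p : ℝ)⁻¹) ^ (j ^ 2) := by
  rw [padicModelQ, norm_pow, Padic.norm_p]

/-- `q_j ∈ ℤ_p`. [folklore] -/
theorem norm_padicModelQ_le_one (j : ℕ) : ‖padicModelQ p j‖ ≤ 1 := by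
  rw [norm_padicModelQ]
  have hp1 : (1 : ℝ) ≤ p := by exact_mod_cast hp.out.one_lt.le
  exact pow_le_one₀ (inv_nonneg.mpr (by positivity)) (inv_le_one_of_one_le₀ hp1)

/-- `q_0 = 1`. [folklore] -/
theorem padicModelQ_zero : padicModelQ p 0 = 1 := by
  simp [padicModelQ]

/-- **(9.9.2)–(9.9.3) at the model**: `‖ξ_j‖ = ‖q_j‖` — Lemma 9.8.2.7 (p434712). [claim: Joshi2024ATS3, status: disputed] -/
theorem norm_padicModelXi (j : ℕ) : ‖padicModelXi p j‖ = ‖padicModelQ p j‖ :=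
  norm_pStar_inv_mul_unitLog_one_add_mul p ℚ_[p] (norm_padicModelQ_le_one p j)

/-- `ξ_j ∈ ℤ_p` (the log-shell coordinate space's unit ball). [folklore] -/
theorem padicModelXi_mem (j : ℕ) : padicModelXi p j ∈ closedBall (0 : ℚ_[p]) 1 := by
  rw [mem_closedBall, dist_zero_right, norm_padicModelXi]
  exact norm_padicModelQ_le_one p j

/-- **Rmk. 9.8.2.3 at the model**: the unit class `ξ_0 = p*⁻¹·log_p(1 + p*)` has norm `1`. [claim: Joshi2024ATS3, status: disputed] -/
theorem norm_padicModelXi_zero : ‖padicModelXi p 0‖ = 1 := by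
  rw [norm_padicModelXi, padicModelQ_zero, norm_one]

/-- The root law (9.9.4) at the model: `‖q_{j}‖ = |q_w^{1/2ℓ}|^{j²/ℓ*²}` with `|q_w^{1/2ℓ}| := p^{−ℓ*²}`, for `j = i + 1`,
`ℓ* ≥ 1`. [claim: Joshi2024ATS3, status: disputed] -/
theorem norm_padicModelQ_succ_eq_rpow {lstar : ℕ} (hl : 0 < lstar) (i : Fin lstar) :
    ‖padicModelQ p ((i : ℕ) + 1)‖ =
      ((p : ℝ) ^ (-((lstar : ℝ) ^ 2))) ^ LocusDatum.scalingExponent lstar i := by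
  have hp0 : (0 : ℝ) < p := by exact_mod_cast hp.out.pos
  have hl0 : (lstar : ℝ) ≠ 0 := by exact_mod_cast hl.ne'
  rw [norm_padicModelQ, ← Real.rpow_mul hp0.le, LocusDatum.scalingExponent, inv_pow, ← Real.rpow_natCast,
    ← Real.rpow_neg hp0.le]
  congr 1
  field_simp
  push_cast
  ring

/-! ## 2. The model -/

variable (lstar : ℕ)

/-- **The `p`-adic model of the collation signature** (module docstring for the dictionary of its fields): one place,
`V = ℚ_p`, shell `ℤ_p`, carriers `ℤ_p` collated by inclusion, `|−| = ‖−‖_p`, `Y = Fin (ℓ*+1)`, one Ansatz point with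
extended tuple `j ↦ j`, `ξ_{y_j} = p*⁻¹·log_p(1 + p*·p^{j²})`, unit class `= ξ_{y_0}`, identity closures, product codomains
with sup norms. [claim: Joshi2024ATS3, status: disputed] -/
def padicLociModel : TensorPacketLociDatum Unit (fun _ => ℚ_[p]) (Fin lstar → Unit → ℚ_[p])
    (∀ i : Fin lstar, Fin ((i : ℕ) + 2) → Unit → ℚ_[p]) where
  lstar := lstar
  Wss := Finset.univ
  Y := Fin (lstar + 1)
  y₀ := Fin.last lstar
  Z := Unit
  ext := fun _ j => j
  zTheta := ()
  zTheta_last := rfl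
  sym := {id}
  H := fun _ _ => ↥(closedBall (0 : ℚ_[p]) 1)
  xi := fun y _ => ⟨padicModelXi p (y : ℕ), padicModelXi_mem p _⟩
  one := fun _ _ => ⟨padicModelXi p 0, padicModelXi_mem p 0⟩
  nrm := fun _ _ h => ‖(h : ℚ_[p])‖
  shell := fun _ => closedBall (0 : ℚ_[p]) 1
  shell_compact := fun _ => isCompact_closedBall _ _
  coll := fun _ _ => {Subtype.val}
  coll_nonempty := fun _ _ => Set.singleton_nonempty _
  coll_mem := by
    rintro _ _ ι hι h
    rw [mem_singleton_iff.mp hι]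
    exact h.2
  convJ := ClosureOperator.id _
  convM := ClosureOperator.id _
  toTensorJ := id
  toTensorJ_continuous := continuous_id
  toTensorM := id
  toTensorM_continuous := continuous_id
  tensorMJ := fun x i w => x i (Fin.last _) w
  tnrmJ := fun x => ‖x‖
  tnrmJ_continuous := continuous_norm
  tnrmM := fun x => ‖x‖
  tnrmM_continuous := continuous_norm

/-- The model's `ℓ*` is the given one. [folklore] -/
@[simp] theorem padicLociModel_lstar : (padicLociModel p lstar).lstar = lstar := rfl

/-- Non-degeneracy: the Ansatz index type is inhabited (by the standard point). [folklore] -/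
theorem padicLociModel_Z_nonempty : Nonempty (padicLociModel p lstar).Z := ⟨(padicLociModel p lstar).zTheta⟩

/-- Non-degeneracy: the log-shell is the genuine `ℤ_p ⊂ ℚ_p` (compact, infinite, `p`-adic topology). [folklore] -/
theorem padicLociModel_shell (w : Unit) : (padicLociModel p lstar).shell w = closedBall (0 : ℚ_[p]) 1 := rfl

/-! ## 3. The readings of `ThetaLociSizesReadings` hold at the model -/

/-- ISOMETRIC COLLATION with the continuous gauge `ν_w = ‖−‖_p`: the one collation map is the inclusion `ℤ_p ⊂ ℚ_p` and the
intrinsic norm is the `p`-adic norm. [folklore] -/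
theorem padicLociModel_collationReading :
    ∀ y w ι, ι ∈ (padicLociModel p lstar).coll y w → ∀ h, (padicLociModel p lstar).nrm y w h = ‖ι h‖ := by
  rintro y w ι hι h
  have hι' : ι = Subtype.val := mem_singleton_iff.mp hι
  subst hι'
  rfl

/-- The `p`-ADIC READING of the unit class: its intrinsic norm is `‖p*⁻¹·log_p(1 + p*)‖`. [folklore] -/
theorem padicLociModel_nrm_one (y : (padicLociModel p lstar).Y) (w : Unit) :
    (padicLociModel p lstar).nrm y w ((padicLociModel p lstar).one y w) =
      ‖(((pStar p : ℕ) : ℚ_[p]))⁻¹ * unitLog (1 + ((pStar p : ℕ) : ℚ_[p]))‖ := by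
  change ‖padicModelXi p 0‖ = _
  rw [padicModelXi, padicModelQ_zero, mul_one]

/-- The LOG-READING of the standard norms: `|ξ_{w,j}| = ‖p*⁻¹·log_p(1 + p*·q_j)‖`, `q_j = p^{j²}`, `j = i + 1`. [folklore] -/
theorem padicLociModel_standardNorm (w : Unit) (i : Fin lstar) :
    (padicLociModel p lstar).standardNorm w i =
      ‖(((pStar p : ℕ) : ℚ_[p]))⁻¹ * unitLog (1 + ((pStar p : ℕ) : ℚ_[p]) * padicModelQ p ((i : ℕ) + 1))‖ :=
  rfl

/-! ## 4. Every reading predicate of the T-22 files holds at the model -/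

/-- `ShellsConvexStableJ` (identity closure). [folklore] -/
theorem padicLociModel_shellsConvexStableJ : (padicLociModel p lstar).ShellsConvexStableJ := fun _ hx => hx

/-- `ShellsConvexStableM` (identity closure). [folklore] -/
theorem padicLociModel_shellsConvexStableM : (padicLociModel p lstar).ShellsConvexStableM := fun _ hx => hx

/-- `LocusInShellsJ` (Thm-Def 9.8.1.1 (7)). [folklore] -/
theorem padicLociModel_locusInShellsJ : (padicLociModel p lstar).LocusInShellsJ :=
  (padicLociModel p lstar).locusInShellsJ_of (padicLociModel_shellsConvexStableJ p lstar)

/-- `LocusInShellsM`. [folklore] -/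
theorem padicLociModel_locusInShellsM : (padicLociModel p lstar).LocusInShellsM :=
  (padicLociModel p lstar).locusInShellsM_of (padicLociModel_shellsConvexStableM p lstar)

/-- `CollInjective` (the inclusion `ℤ_p ⊂ ℚ_p` is injective). [folklore] -/
theorem padicLociModel_collInjective : (padicLociModel p lstar).CollInjective := by
  rintro y w ι hι
  rw [mem_singleton_iff.mp hι]
  exact Subtype.val_injective

/-- `CollOntoShell` (the inclusion is onto the shell `ℤ_p`). [folklore] -/
theorem padicLociModel_collOntoShell : (padicLociModel p lstar).CollOntoShell := by
  rintro y w ι hι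
  rw [mem_singleton_iff.mp hι]
  exact Subtype.range_coe

/-- `PlaceSizeBounded` — Cor. 9.8.2.6 intrinsic at `w`, from the isometric continuous reading (p435679). [folklore] -/
theorem padicLociModel_placeSizeBounded (w : Unit) : (padicLociModel p lstar).PlaceSizeBounded w :=
  (padicLociModel p lstar).placeSizeBounded_of_continuousCollationReading (padicLociModel_collationReading p lstar)
    (fun _ _ => norm_nonneg _) (fun _ => continuous_norm) w

/-- `ProdSizeBounded` — Cor. 9.8.2.6 intrinsic, from the isometric continuous reading (p435679). [folklore] -/
theorem padicLociModel_prodSizeBounded : (padicLociModel p lstar).ProdSizeBounded :=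
  (padicLociModel p lstar).prodSizeBounded_of_continuousCollationReading (padicLociModel_collationReading p lstar)
    (fun _ _ => norm_nonneg _) fun _ => continuous_norm

/-- `OneUnitNorm` — Rmk. 9.8.2.3, from the `p`-adic reading (p435679, p434712). [folklore] -/
theorem padicLociModel_oneUnitNorm : (padicLociModel p lstar).OneUnitNorm :=
  (padicLociModel p lstar).oneUnitNorm_of_padicReading (fun _ => p) (fun _ => ℚ_[p])
    (padicLociModel_nrm_one p lstar)

/-- `UnitNormOffSS` — vacuous here by design: the one place is in `𝕍^{odd,ss}`. [folklore] -/
theorem padicLociModel_unitNormOffSS : (padicLociModel p lstar).UnitNormOffSS :=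
  fun _ w hw => absurd (Finset.mem_univ w) hw

/-- **ALL reading predicates of the T-22 files hold at the `p`-adic model** (conjunction). [folklore] -/
theorem padicLociModel_allReadings :
    (padicLociModel p lstar).ShellsConvexStableJ ∧ (padicLociModel p lstar).ShellsConvexStableM ∧
    (padicLociModel p lstar).LocusInShellsJ ∧ (padicLociModel p lstar).LocusInShellsM ∧
    (padicLociModel p lstar).CollInjective ∧ (padicLociModel p lstar).CollOntoShell ∧
    (padicLociModel p lstar).UnitNormOffSS ∧ (padicLociModel p lstar).OneUnitNorm ∧
    (padicLociModel p lstar).ProdSizeBounded ∧ (∀ w, (padicLociModel p lstar).PlaceSizeBounded w) :=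
  ⟨padicLociModel_shellsConvexStableJ p lstar, padicLociModel_shellsConvexStableM p lstar,
    padicLociModel_locusInShellsJ p lstar, padicLociModel_locusInShellsM p lstar, padicLociModel_collInjective p lstar,
    padicLociModel_collOntoShell p lstar, padicLociModel_unitNormOffSS p lstar, padicLociModel_oneUnitNorm p lstar,
    padicLociModel_prodSizeBounded p lstar, padicLociModel_placeSizeBounded p lstar⟩

/-! ## 5. E-t4's spine at the model: (9.9.4) and Thm. 9.9.1's `w`-component for the projection -/

/-- `|q_w^{1/2ℓ}| := p^{−ℓ*²} ∈ (0, 1)`: positivity. [folklore] -/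
theorem padicModel_qroot_pos : 0 < (p : ℝ) ^ (-((lstar : ℝ) ^ 2)) :=
  Real.rpow_pos_of_pos (by exact_mod_cast hp.out.pos) _

/-- … and `< 1` for `ℓ* ≥ 1`. [folklore] -/
theorem padicModel_qroot_lt_one (hl : 0 < lstar) : (p : ℝ) ^ (-((lstar : ℝ) ^ 2)) < 1 := by
  have h0 : (0 : ℝ) < lstar := by exact_mod_cast hl
  exact Real.rpow_lt_one_of_one_lt_of_neg (by exact_mod_cast hp.out.one_lt) (neg_neg_of_pos (by positivity))

/-- **(9.9.4) `ValuationScaling` for the model's projection** (`qroot = p^{−ℓ*²}`, any hull volume), from the log-reading +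
root law (p435679). [claim: Joshi2024ATS3, status: disputed] -/
theorem padicLociModel_valuationScaling (hl : 0 < lstar) (w : Unit) (hullVol : ℝ) :
    ((padicLociModel p lstar).toLocusDatum w _ (padicModel_qroot_pos p lstar) (padicModel_qroot_lt_one p lstar hl)
      hullVol).ValuationScaling :=
  (padicLociModel p lstar).toLocusDatum_valuationScaling_of_logReading p (fun _ => ℚ_[p]) w
    (fun i => padicModelQ p ((i : ℕ) + 1)) (padicLociModel_standardNorm p lstar w) _ _ _ hullVol
    fun i => norm_padicModelQ_succ_eq_rpow p hl i

/-- **Thm. 9.9.1, `w`-component, HOLDS at the model's projection**: `|q_w^{1/2ℓ}|^{ℓ*} ≤ |Θ̃_{Joshi,w}|`, from readings only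
(p435679 `fundamentalEstimateSup_of_readings`). [claim: Joshi2024ATS3, status: disputed] -/
theorem padicLociModel_fundamentalEstimateSup (hl : 0 < lstar) (w : Unit) (hullVol : ℝ) :
    ((padicLociModel p lstar).toLocusDatum w _ (padicModel_qroot_pos p lstar) (padicModel_qroot_lt_one p lstar hl)
      hullVol).FundamentalEstimateSup :=
  (padicLociModel p lstar).fundamentalEstimateSup_of_readings p (fun _ => ℚ_[p])
    (padicLociModel_collationReading p lstar) (fun _ _ => norm_nonneg _) (fun _ => continuous_norm) w
    (fun i => padicModelQ p ((i : ℕ) + 1)) (padicLociModel_standardNorm p lstar w) _ _ _ hullVol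
    fun i => norm_padicModelQ_succ_eq_rpow p hl i

end Summit.ABC.IUTFork.Joshi.ATS3

end
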